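import Literature.Computability.Complexity.TimeHierarchyAE
import Literature.Computability.Complexity.TimeHierarchyDiagonal
import Literature.Computability.Complexity.UniformDerandomization
import Literature.Computability.Complexity.RandomizedProofs
import Literature.Computability.Complexity.CoinTruncation
import Literature.Computability.Complexity.BrickAlgebra
import Literature.Computability.Complexity.FPStringBricks
import Literature.Computability.Complexity.ExpTimeMaps
import HarnessLib

/-!
# The converse of Impagliazzo–Wigderson 1998: heuristic derandomization of `BPP` on all samplable ensembles forces `BPP ≠ EXP`

Impagliazzo–Wigderson (FOCS 1998 = JCSS 63 (2001)) prove, besides their main theorem (Thm. 5: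
`BPP ≠ EXP ⇒ BPP ⊂ i.o.-Heur_{1/n^c} SUBEXP` for every `c`, vendored in the tree as the named
fact `impagliazzoWigderson1998_samplable` in van Melkebeek's form, `UniformDerandomization.lean`),
a "sharp converse" and summarise (Cor. 9, p. 4 of the held text `paper:doi-10-1006-jcss-2001-1780`):
«Exactly one of the following holds: (1) `BPP = EXP`; (2) `BPP ⊆ i.o.-HeurTIME_{1/n^c}(2^{n^δ})`
for every `δ > 0` and `c > 0`», where (Def. 1, p. 3) membership of a language in a `Heur` class
means membership of the pair `(f, μ)` for EVERY polynomially sampleable ensemble `μ`. The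
implication (2) ⇒ ¬(1) — heuristic subexponential simulations of `BPP` on all samplable
ensembles are incompatible with `BPP = EXP` — is the elementary half: `EXP` contains a language
which every `DTIME(2^n)` machine decides wrongly on some input of EVERY large length (the
almost-everywhere time hierarchy, Buhrman–Fortnow–Pavan 2005, proof of Thm. 3.1: «a set `A` in
`DTIME(2^{dn})` such that for every Turing machine `M` using time bounded by `2^{(d-1)n}`, and for
all but a finite number of `n`, `M` fails to compute `A` correctly on some input of length `n`»;
in the tree: `exists_ae_hard_mem_E`, `TimeHierarchyAE.lean`), and the wrong inputs — padded
machine headers `⟨e_M, 0^{n-2|e_M|-2}⟩` — are produced by a polynomial-time (indeed deterministic)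
sampler, so that no such machine is even infinitely-often heuristically correct on that samplable
ensemble.

This file PROVES that half in the exact format in which the tree states the IW conclusion
(van Melkebeek 2000, Thm. 6.2.1, the consequent of `impagliazzoWigderson1998_samplable`:
for `A ∈ BPP` and `ε > 0` a language `B ∈ DTIME[2^{n^ε}]` which, for every `d` and every
length-preserving polynomial-time samplable ensemble `D`, agrees with `A` with `D_m`-probability
`> 1 − m^{−d}` for infinitely many `m`):

* `BPP_ne_EXP_of_heuristic_derandomization` — **that conclusion implies `BPP ≠ EXP`**. Hence,
  together with the named fact, `BPP ≠ EXP` is EQUIVALENT to it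
  (`BPP_ne_EXP_iff_heuristic_derandomization`, conditional on `impagliazzoWigderson1998_samplable`
  only for the forward direction) — the tree's form of IW's gap theorem, Cor. 9.

The engine, proved here from the tree's time hierarchy:

* `FuelledSimulator.diagLang_eventually_disagree_header` and `exists_ae_hard_mem_E_header` — the
  almost-everywhere hard language of `TimeHierarchyAE.lean` with its refuting inputs RECORDED:
  for every `B ∈ DTIME(2^{en})` there are a header `e_B` and `n₀ ≥ 2|e_B| + 2` such that the
  padded header `⟨e_B, 0^{n − 2|e_B| − 2}⟩` of length `n` lies in exactly one of `A`, `B` for every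
  `n ≥ n₀` (same proof as `diagLang_eventually_disagree`, which only asserted `∃ x`);
* `hdrPadFn e` — the string map `u ↦ ⟨e, 0^{|u| − 2|e| − 2}⟩` (truncated to length `|u|` when
  `|u| < 2|e| + 2`), assembled from the tree's bricks (`fanoutFn`, `truncSndFn`, `Brick.sndF`,
  `Kannan.zerosFn`), is in `FP` and length preserving (`hdrPadFn_mem_FP`, `length_hdrPadFn`,
  `hdrPadFn_apply_of_le`);
* `isPolySamplable_pure` / `prob_pure` — a polynomial-time string function of `1^m` run coin-free
  (`RandAlg.ofDet`, `RandAlg.IsPolyTime.ofDet_holds`) samples the point-mass ensemble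
  `m ↦ δ_{w(m)}`, whose event probabilities are indicators;
* `exists_mem_E_forall_DTIME_exp_not_ioHeuristic` — **there is `A ∈ E` such that for every
  `B ∈ DTIME(2^n)` some length-preserving polynomial-time samplable ensemble `D` (the point masses
  at the refuting padded headers of `B`) has `Pr_{D_m}[A(x) = B(x)] = 0` for all large `m`**: on
  `D`, `B` is not even an infinitely-often heuristic algorithm for `A`, for any error bound `< 1`.

## Faithfulness notes

* IW's own converse (Thm. 6 / Cor. 7) is stronger and about the UNIFORM ensemble with advice
  («there are functions in `EXP ∩ P/poly` that are not in `i.o.-HeurTIME_{2/3}(2^{o(n)})/o(n)`»,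
  by a hashing argument); it is NOT typed here. What is typed is the direction (2) ⇒ ¬(1) of
  Cor. 9 in van Melkebeek's samplable-ensemble format, where the simulating language `B` is chosen
  before the ensemble (as in Thm. 6.2.1), so that point-mass samplers suffice.
  TODO(general form): IW's order of quantifiers in (2) (the algorithm may depend on `μ` and `c`)
  needs ONE `B`-independent samplable ensemble charging every padded header `⟨e, 0^{m-2|e|-2}⟩` with
  mass `≥ 4^{-|e|-1}` (parse the header off the coin string); not typed here.
* `DTIME[2^{n^ε}]` at `ε = 1` is literally `DTIME(2^n)` (`two_pow_ceil_rpow_one`), inside which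
  the a.e.-hard language's competitors `DTIME(2^{1·n})` live; `E ⊆ EXP` (the tree's `E_subset_EXP`, `ExpTimeMaps.lean`).
* No named fact is introduced; `impagliazzoWigderson1998_samplable` is only CONSUMED (in the
  `iff`).

## References

* [ImpagliazzoWigderson2001] R. Impagliazzo, A. Wigderson, *Randomness vs time: derandomization
  under a uniform assumption*, JCSS 63 (2001) 672–688 = FOCS 1998; held text pp. 3–4: Def. 1,
  Thm. 5, Thm. 6, Cor. 7, Cor. 9.
* [VanMelkebeek2000] D. van Melkebeek, *Randomness and Completeness in Computational Complexity*,
  LNCS 1950 (2000), Thm. 6.2.1 (p. 142).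
* [BuhrmanFortnowPavan2004] H. Buhrman, L. Fortnow, A. Pavan, *Some results on derandomization*,
  Theory Comput. Syst. 38 (2005) 211–227, Thm. 3.1 (proof) — cite-only (acq-00921), quoted from
  `TimeHierarchyAE.lean`.
* [AroraBarakCC2009] S. Arora, B. Barak, *Computational Complexity*, CUP 2009, Thm. 3.1 (proof).
-/

noncomputable section

namespace Literature.Computability.Complexity

open _root_.Computability Turing Filter Topology MetaComplexity

/-! ### The padded-header map `u ↦ ⟨e, 0^{|u| - 2|e| - 2}⟩` is a length-preserving `FP` map -/

/-- The padded-header string map of a fixed header `e`: `u ↦ (⟨e, ε⟩ ++ 0^{|u|}) ↾ |u|`, i.e.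
`⟨e, 0^{|u| − 2|e| − 2}⟩` as soon as `|u| ≥ 2|e| + 2` (`hdrPadFn_apply_of_le`), and a length-`|u|`
prefix of the doubled header otherwise; assembled from the tree's `FP` bricks (fan-out, coin
truncation `truncSndFn X`, second projection). These are the inputs on which the time-hierarchy
diagonal language refutes the machine with header `e` (Arora–Barak 2009, proof of Thm. 3.1).
[cite: AroraBarakCC2009, Thm. 3.1 (proof: the padded inputs ⟨M, 1ⁿ⟩)] -/
def hdrPadFn (e : List Bool) : List Bool → List Bool :=
  Brick.sndF ∘ truncSndFn Polynomial.X ∘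
    fanoutFn id (fun u => boolPair e [] ++ Kannan.zerosFn u)

/-- Closed form: `hdrPadFn e u = (⟨e, ε⟩ ++ 0^{|u|}) ↾ |u|`.
[cite: AroraBarakCC2009, Thm. 3.1 (proof)] -/
theorem hdrPadFn_apply (e u : List Bool) :
    hdrPadFn e u = (boolPair e [] ++ List.replicate u.length false).take u.length := by
  simp [hdrPadFn, Function.comp_apply, fanoutFn_apply, truncSndFn_boolPair, Kannan.zerosFn_apply]

/-- `hdrPadFn e` is length preserving. [cite: AroraBarakCC2009, Thm. 3.1 (proof)] -/
theorem length_hdrPadFn (e u : List Bool) : (hdrPadFn e u).length = u.length := by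
  rw [hdrPadFn_apply, List.length_take, List.length_append, List.length_replicate]
  omega

/-- For `|u| ≥ 2|e| + 2` the value is the padded header `⟨e, 0^{|u| − 2|e| − 2}⟩`.
[cite: AroraBarakCC2009, Thm. 3.1 (proof)] -/
theorem hdrPadFn_apply_of_le (e u : List Bool) (h : 2 * e.length + 2 ≤ u.length) :
    hdrPadFn e u = boolPair e (List.replicate (u.length - (2 * e.length + 2)) false) := by
  rw [hdrPadFn_apply]
  have hlen : (boolPair e []).length = 2 * e.length + 2 := by simp [length_boolPair]
  have hpre : boolPair e (List.replicate (u.length - (2 * e.length + 2)) false) =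
      boolPair e [] ++ List.replicate (u.length - (2 * e.length + 2)) false := by
    simp [boolPair, List.append_assoc]
  rw [hpre, List.take_append, List.take_of_length_le (by omega), hlen, List.take_replicate,
    Nat.min_eq_left (Nat.sub_le _ _)]

/-- **`hdrPadFn e ∈ FP`.** [cite: AroraBarakCC2009, Thm. 3.1 (proof), §1.3] -/
theorem hdrPadFn_mem_FP (e : List Bool) : hdrPadFn e ∈ FP :=
  comp_mem_FP Brick.sndF_mem_FP
    (comp_mem_FP (truncSndFn_mem_FP Polynomial.X)
      (fanoutFn_mem_FP (PolyTimeComputable.id _)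
        (append_mem_FP (const_mem_FP (boolPair e [])) Kannan.zerosFn_mem_FP)))

/-- The padded-header map read on unary inputs `1^m` is polynomial-time from `ℕ` (unary) to strings.
[cite: AroraBarakCC2009, Thm. 3.1 (proof), §1.3] -/
theorem polyTimeComputable_hdrPadFn_unary (e : List Bool) :
    PolyTimeComputable unaryEncodeNat (id : List Bool → List Bool)
      (fun m : ℕ => hdrPadFn e (unaryEncodeNat m)) :=
  (hdrPadFn_mem_FP e).of_encode (g := unaryEncodeNat) (fun _ => rfl) (fun _ => rfl)

/-! ### The almost-everywhere diagonal step with the refuting inputs recorded -/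

namespace FuelledSimulator

variable (𝒮 : FuelledSimulator)

/-- **The diagonal step, almost everywhere, with the witness recorded.** Under the hypotheses of
`diagLang_eventually_disagree` (`T, U ≥ id`, `T²/U → 0`, `B ∈ DTIME T`) there are a header `e`
(of a decider of `B`) and `n₀ ≥ 2|e| + 2` such that for every `n ≥ n₀` the padded header
`x = ⟨e, 0^{n − 2|e| − 2}⟩` (of length `n`) satisfies `x ∈ B ↔ x ∉ diagLang U`. Same proof as
`diagLang_eventually_disagree` (Arora–Barak 2009, proof of Thm. 3.1), which only asserted `∃ x`.
[cite: AroraBarakCC2009, Thm. 3.1 (proof)] -/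
theorem diagLang_eventually_disagree_header {T U : ℕ → ℕ} (hT : ∀ n, n ≤ T n) (hU : ∀ n, n ≤ U n)
    (h : Tendsto (fun n => (T n : ℝ) ^ 2 / U n) atTop (𝓝 0)) {B : Language Bool}
    (hB : B ∈ DTIME T) :
    ∃ (e : List Bool) (n₀ : ℕ), 2 * e.length + 2 ≤ n₀ ∧ ∀ n ≥ n₀,
      (boolPair e (List.replicate (n - (2 * e.length + 2)) false) ∈ B ↔
        boolPair e (List.replicate (n - (2 * e.length + 2)) false) ∉ 𝒮.diagLang U) := by
  obtain ⟨c, M, hM⟩ := hB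
  obtain ⟨e, κ, he⟩ := 𝒮.universal M
  obtain ⟨N, hN⟩ := eventually_mul_sq_add_le_of_tendsto_sq_div hU h (κ * (2 * c + 2) ^ 2)
  refine ⟨e, 2 * e.length + 2 + N, by omega, fun n hn => ?_⟩
  have hlen : N ≤ (boolPair e (List.replicate (n - (2 * e.length + 2)) false)).length := by
    rw [length_boolPair, List.length_replicate]; omega
  -- the decider's run on the padded header
  have hrun : M.OutputsWithin (boolPair e (List.replicate (n - (2 * e.length + 2)) false))
      (encodeBool (B.boolIndicator (boolPair e (List.replicate (n - (2 * e.length + 2)) false))))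
      (c * T (boolPair e (List.replicate (n - (2 * e.length + 2)) false)).length + c) :=
    hM _
  -- the fuel suffices
  have hroom : κ * (c * T (boolPair e (List.replicate (n - (2 * e.length + 2)) false)).length + c +
      (boolPair e (List.replicate (n - (2 * e.length + 2)) false)).length) ^ 2 + κ ≤
      U (boolPair e (List.replicate (n - (2 * e.length + 2)) false)).length := by
    generalize hm : (boolPair e (List.replicate (n - (2 * e.length + 2)) false)).length = m at hlen ⊢
    have hTm : m ≤ T m := hT m
    have hm1 : 1 ≤ m := by rw [← hm, length_boolPair]; omega
    have hT1 : c ≤ c * T m := by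
      simpa using Nat.mul_le_mul_left c (le_trans hm1 hTm)
    have h1 : c * T m + c + m ≤ (2 * c + 2) * T m := by nlinarith
    have h2 : κ * (c * T m + c + m) ^ 2 ≤ κ * (2 * c + 2) ^ 2 * T m ^ 2 := by
      have := Nat.pow_le_pow_left h1 2
      calc κ * (c * T m + c + m) ^ 2 ≤ κ * ((2 * c + 2) * T m) ^ 2 := Nat.mul_le_mul_left κ this
        _ = κ * (2 * c + 2) ^ 2 * T m ^ 2 := by ring
    have h3 : κ ≤ κ * (2 * c + 2) ^ 2 := by
      have : 1 ≤ (2 * c + 2) ^ 2 := Nat.one_le_pow _ _ (by omega)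
      nlinarith
    have h4 := hN m hlen
    omega
  -- the simulator flips the decider's answer
  have hflip := he _ _ _ _ hrun hroom
  rw [mem_diagLang_iff, hflip]
  cases hb : B.boolIndicator (boolPair e (List.replicate (n - (2 * e.length + 2)) false))
  · have hx : boolPair e (List.replicate (n - (2 * e.length + 2)) false) ∉ B :=
      (Set.notMem_iff_boolIndicator _ _).2 hb
    simp [hx]
  · have hx : boolPair e (List.replicate (n - (2 * e.length + 2)) false) ∈ B :=
      (Set.mem_iff_boolIndicator _ _).2 hb
    simp [hx]

end FuelledSimulator

/-- **An almost-everywhere-hard language in `E`, with the refuting inputs recorded**: for every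
`e` there is `A ∈ E` such that for every `B ∈ DTIME(2^{en})` there are a header `hdr` and
`n₀ ≥ 2|hdr| + 2` with `⟨hdr, 0^{n−2|hdr|−2}⟩ ∈ B ↔ ⟨hdr, 0^{n−2|hdr|−2}⟩ ∉ A` for every `n ≥ n₀`
(«for all but a finite number of `n`, `M` fails to compute `A` correctly on some input of length
`n`» — namely on its own padded header). Same `A` and same argument as `exists_ae_hard_mem_E`.
[cite: BuhrmanFortnowPavan2004, Thm. 3.1 (proof)] [cite: AroraBarakCC2009, Thm. 3.1 (proof)] -/
theorem exists_ae_hard_mem_E_header (e : ℕ) : ∃ A ∈ E, ∀ B ∈ DTIME (fun n => 2 ^ (e * n)),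
    ∃ (hdr : List Bool) (n₀ : ℕ), 2 * hdr.length + 2 ≤ n₀ ∧ ∀ n ≥ n₀,
      (boolPair hdr (List.replicate (n - (2 * hdr.length + 2)) false) ∈ B ↔
        boolPair hdr (List.replicate (n - (2 * hdr.length + 2)) false) ∉ A) := by
  let 𝒮 : FuelledSimulator := FuelledRun.fuelledSimulator UDet.interp UDet.DR.X UDet.DR.ans UDet.interprets
  set e' := max e 1 with he'
  have he1 : 1 ≤ e' := le_max_right _ _
  have hU := isTimeConstructible_two_pow_mul (c := (2 * e' + 1)) (by omega)
  have hT := isTimeConstructible_two_pow_mul he1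
  refine ⟨𝒮.diagLang fun n => 2 ^ ((2 * e' + 1) * n), ?_, fun B hB => ?_⟩
  · exact Set.mem_iUnion.2 ⟨2 * e' + 1, 𝒮.diagLang_mem_DTIME hU⟩
  · have hB' : B ∈ DTIME fun n => 2 ^ (e' * n) := by
      obtain ⟨a, ha⟩ := hB
      refine ⟨a, timeClass_mono (fun n => ?_) ha⟩
      have : 2 ^ (e * n) ≤ 2 ^ (e' * n) :=
        Nat.pow_le_pow_right Nat.two_pos (Nat.mul_le_mul_right n (le_max_left e 1))
      exact Nat.add_le_add_right (Nat.mul_le_mul_left a this) a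
    exact 𝒮.diagLang_eventually_disagree_header hT.1 hU.1 (tendsto_sq_two_pow_mul_div e') hB'

/-! ### Point-mass ensembles at polynomial-time computable strings are samplable -/

/-- **A point-mass ensemble at a polynomial-time string function of `1^m` is polynomial-time
samplable**: the coin-free algorithm `RandAlg.ofDet w` (`RandAlg.IsPolyTime.ofDet_holds`) has
output distribution `δ_{w(m)}` (`RandAlg.outputPMF_ofDet`). (Bogdanov–Trevisan 2006, Def. 2.1:
the sampler may ignore its coins.) [cite: BogdanovTrevisan2006, Def. 2.1 (PSamp; deterministic samplers)] -/
theorem isPolySamplable_pure {w : ℕ → List Bool}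
    (hw : PolyTimeComputable unaryEncodeNat (id : List Bool → List Bool) w) :
    Ensemble.IsPolySamplable (fun m => PMF.pure (w m)) :=
  ⟨RandAlg.ofDet w, RandAlg.IsPolyTime.ofDet_holds hw, fun m => RandAlg.outputPMF_ofDet w _ m⟩

/-- The support of a point-mass ensemble. [cite: BogdanovTrevisan2006, §2.1 (ensembles)] -/
theorem mem_support_pure_ensemble_iff {w : ℕ → List Bool} (m : ℕ) (x : List Bool) :
    x ∈ ((fun m => PMF.pure (w m) : Ensemble) m).support ↔ x = w m :=
  PMF.mem_support_pure_iff _ _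

open scoped Classical in
/-- Event probabilities of a point-mass ensemble are indicators.
[cite: BogdanovTrevisan2006, §2.1 (ensembles)] -/
theorem prob_pure_ensemble {w : ℕ → List Bool} (m : ℕ) (S : Set (List Bool)) :
    Ensemble.prob (fun m => PMF.pure (w m)) m S = if w m ∈ S then 1 else 0 := by
  rw [Ensemble.prob, PMF.toOuterMeasure_pure_apply]
  split_ifs <;> simp

/-! ### The converse: no language refuted almost everywhere is infinitely-often heuristically easy on all samplable ensembles -/

/-- **A language in `E` on which every `DTIME(2^n)` machine fails, with certainty, on some
length-preserving polynomial-time samplable ensemble, at every large length.** There is `A ∈ E`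
such that for every `B ∈ DTIME(2^n)` some length-preserving polynomial-time samplable ensemble `D`
(the point masses at the refuting padded headers of a decider of `B`) has
`Pr_{x ∼ D_m}[x ∈ A ↔ x ∈ B] = 0` for all large `m` — so `B` is not an infinitely-often heuristic
algorithm for `(A, D)` under any error bound `< 1`. (The elementary half of Impagliazzo–Wigderson's
gap theorem, Cor. 9: the almost-everywhere time hierarchy — Buhrman–Fortnow–Pavan 2005, proof of
Thm. 3.1 — read against samplable ensembles; here with the ensemble chosen after `B`, see the module
docstring.) [cite: ImpagliazzoWigderson2001, Cor. 9 ((2) ⇒ ¬(1), elementary half) with Def. 1 (sampleable ensembles)]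
[cite: BuhrmanFortnowPavan2004, Thm. 3.1 (proof)] -/
theorem exists_mem_E_forall_DTIME_exp_not_ioHeuristic :
    ∃ A ∈ E, ∀ B ∈ DTIME (fun n => 2 ^ n),
      ∃ D : Ensemble, D.IsPolySamplable ∧ (∀ m, ∀ x ∈ (D m).support, x.length = m) ∧
        ∀ᶠ m : ℕ in atTop, D.prob m {x | x ∈ A ↔ x ∈ B} = 0 := by
  classical
  obtain ⟨A, hAE, hA⟩ := exists_ae_hard_mem_E_header 1
  refine ⟨A, hAE, fun B hB => ?_⟩
  have hB' : B ∈ DTIME (fun n => 2 ^ (1 * n)) := by simpa only [one_mul] using hB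
  obtain ⟨hdr, n₀, hn₀, hdis⟩ := hA B hB'
  refine ⟨fun m => PMF.pure (hdrPadFn hdr (unaryEncodeNat m)),
    isPolySamplable_pure (polyTimeComputable_hdrPadFn_unary hdr), fun m x hx => ?_, ?_⟩
  · rw [(mem_support_pure_ensemble_iff (w := fun m => hdrPadFn hdr (unaryEncodeNat m)) m x).1 hx,
      length_hdrPadFn]
    exact unary_decode_encode_nat m
  · filter_upwards [eventually_ge_atTop n₀] with m hm
    rw [prob_pure_ensemble (w := fun m => hdrPadFn hdr (unaryEncodeNat m)), if_neg]
    have hlen : (unaryEncodeNat m).length = m := unary_decode_encode_nat m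
    have hle : 2 * hdr.length + 2 ≤ (unaryEncodeNat m).length := by rw [hlen]; omega
    rw [Set.mem_setOf_eq, hdrPadFn_apply_of_le hdr _ hle, hlen]
    have h := hdis m hm
    tauto

/-- **The converse of Impagliazzo–Wigderson 1998 in the tree's format.** If every `A ∈ BPP` admits,
for every `ε > 0`, a language `B ∈ DTIME[2^{n^ε}]` which for every `d` and every length-preserving
polynomial-time samplable ensemble `D` agrees with `A` with `D_m`-probability `> 1 − m^{−d}` for
infinitely many `m` (the consequent of van Melkebeek's Thm. 6.2.1 = the tree's
`impagliazzoWigderson1998_samplable`), then `BPP ≠ EXP`: otherwise the almost-everywhere-hard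
`A ∈ E ⊆ EXP = BPP` of `exists_mem_E_forall_DTIME_exp_not_ioHeuristic` would get, at `ε = 1`, a
`B ∈ DTIME(2^n)` agreeing with it with positive probability infinitely often on the point-mass
ensemble on which the agreement probability is eventually `0`. (Impagliazzo–Wigderson, Cor. 9:
«Exactly one of the following holds: (1) BPP = EXP (2) BPP ⊆ i.o.−HeurTIME_{1/n^c}(2^{n^δ}) for
every δ > 0 and c > 0» — the direction (2) ⇒ ¬(1), for the tree's (van Melkebeek's) order of
quantifiers.) [cite: ImpagliazzoWigderson2001, Cor. 9 ((2) ⇒ ¬(1)); VanMelkebeek2000 Thm. 6.2.1 (format)] -/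
theorem BPP_ne_EXP_of_heuristic_derandomization
    (h : ∀ A ∈ BPP, ∀ ε : ℝ, 0 < ε →
      ∃ B ∈ DTIME (fun n => 2 ^ ⌈(n : ℝ) ^ ε⌉₊),
        ∀ (d : ℕ) (D : Ensemble), D.IsPolySamplable →
          (∀ m, ∀ x ∈ (D m).support, x.length = m) →
            ∃ᶠ m : ℕ in atTop, 1 - 1 / (m : ℝ) ^ d < D.prob m {x | x ∈ A ↔ x ∈ B}) :
    BPP ≠ EXP := by
  intro hEq
  obtain ⟨A, hAE, hA⟩ := exists_mem_E_forall_DTIME_exp_not_ioHeuristic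
  have hABPP : A ∈ BPP := hEq ▸ E_subset_EXP hAE
  obtain ⟨B, hB, hBD⟩ := h A hABPP 1 one_pos
  have hB' : B ∈ DTIME (fun n => 2 ^ n) := by
    have hfun : (fun n : ℕ => (2 : ℕ) ^ ⌈(n : ℝ) ^ (1 : ℝ)⌉₊) = fun n => 2 ^ n :=
      funext two_pow_ceil_rpow_one
    simpa [hfun] using hB
  obtain ⟨D, hDs, hDl, hD0⟩ := hA B hB'
  have hfreq := hBD 0 D hDs hDl
  obtain ⟨m, hm0, hm⟩ := (hD0.and_frequently hfreq).exists
  rw [hm0, pow_zero, div_one, sub_self] at hm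
  exact lt_irrefl _ hm

/-- **Impagliazzo–Wigderson's gap theorem in the tree's format** (Cor. 9: «either no
derandomization of BPP is possible at all, or otherwise a highly nontrivial derandomization is
possible»): under the named fact `impagliazzoWigderson1998_samplable` (IW Thm. 5 / van Melkebeek
Thm. 6.2.1, the deep direction), `BPP ≠ EXP` is EQUIVALENT to the heuristic subexponential
derandomization of `BPP` on all length-preserving samplable ensembles; the backward direction is
`BPP_ne_EXP_of_heuristic_derandomization`, unconditional.
[cite: ImpagliazzoWigderson2001, Cor. 9 (gap theorem); VanMelkebeek2000 Thm. 6.2.1] -/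
theorem BPP_ne_EXP_iff_heuristic_derandomization (hIW : impagliazzoWigderson1998_samplable) :
    BPP ≠ EXP ↔
      ∀ A ∈ BPP, ∀ ε : ℝ, 0 < ε →
        ∃ B ∈ DTIME (fun n => 2 ^ ⌈(n : ℝ) ^ ε⌉₊),
          ∀ (d : ℕ) (D : Ensemble), D.IsPolySamplable →
            (∀ m, ∀ x ∈ (D m).support, x.length = m) →
              ∃ᶠ m : ℕ in atTop, 1 - 1 / (m : ℝ) ^ d < D.prob m {x | x ∈ A ↔ x ∈ B} :=
  ⟨hIW, BPP_ne_EXP_of_heuristic_derandomization⟩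

end Literature.Computability.Complexity

end
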